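import Summits.Ventures.YMGap.RobustBall.MassGapOnBallZdW
import HarnessLib

/-!
# Venture YMGap, track ROBUST-BALL (tier 2, `ℤ^d`) — monotonicity of the diameter-weighted ball in the weight

HONEST FRAMING. WHAT THIS IS: a venture file (cell `pub-ymgap`, track Y2 ROBUST-BALL, seat ds-2); two bookkeeping facts for
the gauge-invariant diameter-weighted `ℤ^d` ball `MemBallZdW κ ε₀ ε₁` (`MassGapOnBallZdW.lean`): a heavier weight gives a smaller
ball (`MemBallZdW.of_weight_le`: `κ ≤ κ'` ⇒ `MemBallZdW κ' ε₀ ε₁ W → MemBallZdW κ ε₀ ε₁ W`), hence a mass-gap row at weight `κ`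
is a row at every `κ' ≥ κ` (`MassGapOnBallZdW.of_weight_le`) — the rows at `κ = log 2` cover every `2^{c·diam}`-weighted ball with
`c ≥ 1`. WHAT IT IS NOT: no door, no number; nothing about the continuum.
-/

noncomputable section

open MeasureTheory Function Finset
open Literature.Probability.LatticeModels
open Literature.Probability.LatticeModels.DobrushinMetric
open Literature.MathematicalPhysics.QuantumLattice
open Literature.MathematicalPhysics.QuantumFieldTheory hiding ZdEdge

namespace Summit.Ventures.YMGap.RobustBall

variable {d N : ℕ}

/-- **A heavier weight gives a smaller ball**: for `κ ≤ κ'`, every member of `MemBallZdW κ' ε₀ ε₁` is a member of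
`MemBallZdW κ ε₀ ε₁` (the `e^{κ·diam}`-weighted loads are dominated by the `e^{κ'·diam}`-weighted ones). [folklore] -/
theorem MemBallZdW.of_weight_le {κ κ' ε₀ ε₁ : ℝ} (hκ : κ ≤ κ') {W : Potential (ZdEdge d) (SUN N)}
    (h : MemBallZdW κ' ε₀ ε₁ W) : MemBallZdW κ ε₀ ε₁ W := by
  classical
  obtain ⟨osc, lip, hosc, hlip, hoscs, hosca, hlips, hlipa⟩ := h.loads
  have hw : ∀ X : Finset (ZdEdge d), Real.exp (κ * linkDiamZd X) ≤ Real.exp (κ' * linkDiamZd X) := fun X =>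
    Real.exp_le_exp.2 (mul_le_mul_of_nonneg_right hκ (Nat.cast_nonneg _))
  have hosc_le : ∀ (e : ZdEdge d) (X : Finset (ZdEdge d)),
      (if e ∈ X then Real.exp (κ * linkDiamZd X) * osc X e else 0) ≤
        (if e ∈ X then Real.exp (κ' * linkDiamZd X) * osc X e else 0) := fun e X => by
    split_ifs
    · exact mul_le_mul_of_nonneg_right (hw X) ((hosc X).nonneg e)
    · exact le_rfl
  have hosc0 : ∀ (e : ZdEdge d) (X : Finset (ZdEdge d)),
      0 ≤ (if e ∈ X then Real.exp (κ * linkDiamZd X) * osc X e else 0) := fun e X => by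
    split_ifs; exacts [mul_nonneg (Real.exp_nonneg _) ((hosc X).nonneg e), le_rfl]
  have hlip_le : ∀ (v : Site d) (X : Finset (ZdEdge d)),
      (if (∃ μ : Fin d, ((v, μ) : ZdEdge d) ∈ X) then Real.exp (κ * linkDiamZd X) * ∑ y ∈ X, lip X y else 0) ≤
        (if (∃ μ : Fin d, ((v, μ) : ZdEdge d) ∈ X) then Real.exp (κ' * linkDiamZd X) * ∑ y ∈ X, lip X y else 0) :=
    fun v X => by
      split_ifs
      · exact mul_le_mul_of_nonneg_right (hw X) (Finset.sum_nonneg fun y _ => (hlip X).nonneg y)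
      · exact le_rfl
  have hlip0 : ∀ (v : Site d) (X : Finset (ZdEdge d)),
      0 ≤ (if (∃ μ : Fin d, ((v, μ) : ZdEdge d) ∈ X) then Real.exp (κ * linkDiamZd X) * ∑ y ∈ X, lip X y else 0) :=
    fun v X => by
      split_ifs; exacts [mul_nonneg (Real.exp_nonneg _) (Finset.sum_nonneg fun y _ => (hlip X).nonneg y), le_rfl]
  refine ⟨h.continuous, h.dependsOn, h.gaugeInvariant, h.summable, osc, lip, hosc, hlip,
    fun e => Summable.of_nonneg_of_le (hosc0 e) (hosc_le e) (hoscs e),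
    fun e => le_trans ((Summable.of_nonneg_of_le (hosc0 e) (hosc_le e) (hoscs e)).tsum_le_tsum (hosc_le e) (hoscs e))
      (hosca e),
    fun v => Summable.of_nonneg_of_le (hlip0 v) (hlip_le v) (hlips v),
    fun v => le_trans ((Summable.of_nonneg_of_le (hlip0 v) (hlip_le v) (hlips v)).tsum_le_tsum (hlip_le v) (hlips v))
      (hlipa v)⟩

/-- **A mass-gap row at weight `κ` is a row at every heavier weight `κ' ≥ κ`.** [folklore] -/
theorem MassGapOnBallZdW.of_weight_le {β κ κ' ε₀ ε₁ : ℝ} (hκ : κ ≤ κ') (h : MassGapOnBallZdW d N β κ ε₀ ε₁) :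
    MassGapOnBallZdW d N β κ' ε₀ ε₁ := fun W hW => h W (hW.of_weight_le hκ)

end Summit.Ventures.YMGap.RobustBall

end
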